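import Summits.NavierStokesRegularity.NavierStokesRegularity.Theses.QuasipotentialCoercivity
import HarnessLib

/-!
# Birth skeleton (BC3) — child II `ScaledEnergyActionBound` of the Type-I/Type-II split of
# `ActionCoercivityEnstrophy` (route QuasipotentialCoercivity; crux-strategist, stmt-NavierStokesRegularity-1443)

Child II (TYPE-II EXCLUSION AT BOUNDED COST): for every `(ν, τ, a)` there is `M` with
`∫_{B(y,r)} |x|² ≤ M r` for all `y`, `r > 0` and every state `x` of the reachable set `R(ν, τ, a)`
(uniform bound of the scale-invariant local kinetic energy = CKN/Seregin quantity `A`, i.e. of the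
Morrey `M^{2,1}` size of reachable states).

LINE (two registered stubs, composition kernel-checked):
* `stub_weakL3_reach` — UNIFORM WEAK-`L³` BOUND ON THE REACHABLE SET: `∃ W(ν,τ,a)`,
  `t³ · |{|x| > t}| ≤ W` for all `t > 0`, every reachable `x`.  The Lorentz level `L^{3,∞}` sits
  strictly between the companion crux #2 (`ActionCoercivityL3`: `L³ ⊂ L^{3,∞}`, Chebyshev) and child
  II (`L^{3,∞} ⊂ M^{2,1}`, layer cake), and is exactly the level that does NOT exclude Type-I /
  self-similar-rate blow-up (`|y|⁻¹ ∈ L^{3,∞} ∖ L³`; Leray / DSS profiles have constant `L^{3,∞}`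
  norm), so this stub stays on the Type-II side of the seam.  Open (a uniform critical a-priori
  bound); implied by #2; the hardest stub.
* `stub_layerCake` — LORENTZ–HÖLDER ON BALLS (pure measure theory, provable now, M-sized):
  `t³|{|x|>t}| ≤ W ⇒ ∫_{B(y,r)}|x|² ≤ M(W) r` by the layer-cake formula,
  `∫_{B_r}|x|² = ∫₀^∞ 2t |B_r ∩ {|x|>t}| dt ≤ ∫₀^∞ 2t min(|B₁| r³, W t⁻³) dt = 3 |B₁|^{1/3} W^{2/3} r`
  (Mathlib `MeasureTheory.lintegral_rpow_eq_lintegral_meas_lt_mul`); `Continuous x` supplies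
  measurability (reachable states are smooth slices of classical solutions).
* `ScaledEnergyActionBound_of : ScaledEnergyActionBound` (the child decl BY NAME; A12 shape — no hypotheses,
  the two stubs used inside), real proof: continuity of the reachable state `x = v T₁` from
  `IsClassicalNSSolutionOn.contDiff_velocity` at `T₁ ∈ [0, T₂)`.

Probes (BC3): `stub_weakL3_reach → ScaledEnergyActionBound`, `→ NavierStokesRegularity` and
`stub_layerCake → …` FAIL under `first | exact? | simpa | aesop` (NOTES.md, probe record).
References: Caffarelli–Kohn–Nirenberg 1982 (quantity `A`); G. Seregin, J. Math. Sci. 143 (2007)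
(critical Morrey estimates); L. Grafakos, Classical Fourier Analysis, §1.4 (Lorentz–Hölder);
Tao 2013 = arXiv:1108.1165 Thm 1.20 (quantitative ⇔ qualitative regularity, the calibration).
-/

set_option linter.dupNamespace false

noncomputable section

open Literature.Analysis.FluidPDE MeasureTheory Set Function Filter Topology Metric
open scoped ENNReal NNReal

namespace Summit.NavierStokesRegularity.NavierStokesRegularity.Cruxes.ScaledEnergyActionBound.Birth

/-- **Stub 1 (hardest; open): uniform weak-`L³` bound on the reachable set.** [conjecture-level
stub of the line; implied by crux #2 `ActionCoercivityL3` via Chebyshev] -/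
theorem stub_weakL3_reach :
    ∀ ν : ℝ, 0 < ν → ∀ τ : ℝ, 0 < τ → ∀ a : NNReal, ∃ W : NNReal, ∀ x : EuclideanSpace ℝ (Fin 3) → EuclideanSpace ℝ (Fin 3), (∃ (T₀ T₁ : ℝ) (w : ℝ → EuclideanSpace ℝ (Fin 3) → EuclideanSpace ℝ (Fin 3)) (q : ℝ → EuclideanSpace ℝ (Fin 3) → ℝ) (g : ℝ → EuclideanSpace ℝ (Fin 3) → EuclideanSpace ℝ (Fin 3)), (0 < T₀ ∧ Literature.Analysis.FluidPDE.IsClassicalNSSolutionOn (Set.Icc 0 T₀) ν g w q ∧ Literature.Analysis.FluidPDE.HasUniformRapidDecayOn (Set.Icc 0 T₀) w ∧ w 0 = 0 ∧ (∫⁻ s in Set.Icc 0 T₀, Literature.Analysis.FluidPDE.eEnergy (g s)) ≤ (a : ENNReal)) ∧ (0 ≤ T₁ ∧ T₀ + T₁ ≤ τ ∧ ∃ (T₂ : ℝ) (v : ℝ → EuclideanSpace ℝ (Fin 3) → EuclideanSpace ℝ (Fin 3)) (pv : ℝ → EuclideanSpace ℝ (Fin 3) → ℝ), T₁ < T₂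 ∧ Literature.Analysis.FluidPDE.IsClassicalNSSolutionOn (Set.Ico 0 T₂) ν 0 v pv ∧ Literature.Analysis.FluidPDE.IsLerayHopfOn T₂ ν 0 (w T₀) v ∧ v 0 = w T₀ ∧ v T₁ = x)) → ∀ t : ℝ, 0 < t → (ENNReal.ofReal t) ^ 3 * MeasureTheory.volume {z : EuclideanSpace ℝ (Fin 3) | t < ‖x z‖} ≤ (W : ENNReal) := by
  sorry

/-- **Stub 2 (provable now): Lorentz–Hölder on balls by layer cake.** For a continuous field with
`t³ |{|x| > t}| ≤ W` for all `t > 0`: `∫_{B(y,r)} |x|² ≤ M(W) · r` for all balls. [folklore;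
Grafakos, Classical Fourier Analysis, Ex. 1.1.11 / §1.4] -/
theorem stub_layerCake :
    ∀ W : NNReal, ∃ M : NNReal, ∀ x : EuclideanSpace ℝ (Fin 3) → EuclideanSpace ℝ (Fin 3), Continuous x → (∀ t : ℝ, 0 < t → (ENNReal.ofReal t) ^ 3 * MeasureTheory.volume {z : EuclideanSpace ℝ (Fin 3) | t < ‖x z‖} ≤ (W : ENNReal)) → ∀ (y : EuclideanSpace ℝ (Fin 3)) (r : ℝ), 0 < r → (∫⁻ z in Metric.ball y r, ‖x z‖ₑ ^ 2) ≤ (M : ENNReal) * ENNReal.ofReal r := by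
  sorry

/-- **Skeleton theorem (A12 shape, kernel-checked): child II BY NAME from the two stubs** (no
hypotheses; the registered stubs are used inside; sorries live only in `stub_*`). -/
theorem ScaledEnergyActionBound_of :
    Summit.NavierStokesRegularity.NavierStokesRegularity.Theses.QuasipotentialCoercivity.ScaledEnergyActionBound := by
  intro ν hν τ hτ a
  obtain ⟨W, hWx⟩ := stub_weakL3_reach ν hν τ hτ a
  obtain ⟨M, hM⟩ := stub_layerCake W
  refine ⟨M, ?_⟩
  rintro x ⟨T₀, T₁, w, q, g, hforced, hT₁, hsum, T₂, v, pv, hT₁₂, hv, hLH, hv0, hvx⟩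
  have hx : Continuous x := by
    have h := (hv.contDiff_velocity ⟨hT₁, hT₁₂⟩).continuous
    rwa [hvx] at h
  exact hM x hx (hWx x ⟨T₀, T₁, w, q, g, hforced, hT₁, hsum, T₂, v, pv, hT₁₂, hv, hLH, hv0, hvx⟩)

end Summit.NavierStokesRegularity.NavierStokesRegularity.Cruxes.ScaledEnergyActionBound.Birth

end
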